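import Summits.CriticalPhenomena.PercolationContinuityZ3.Theorems.SoloBlindFinRungQuantitative
import HarnessLib

/-!
# Every period under a quantitative line rate

The quantitative criterion of `SoloBlindFinRungQuantitative` for the fully attached fin (`M = 1`)
extends verbatim to every period `M ≥ 1` of the periodic fins `S_M` of `SoloBlindPeriodicFinLadder`:

  `T₀ < ∞` and `p_c(ℤ³)² · T₀ · B_M < 1  ⟹  M ∈ finPeriods`,   `B_M := Σ_{j ≠ 0} β(M j)`,

where `T₀ = Σ_{w≠0} τ_ℍ(w)` is the half-space line sum (`T₀ < ∞` is `LineRate`) and `β` the boundary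
two-point function of the planar fin half-plane at `p_c(ℤ³)`.  This interpolates between the two landed
statements: `M = 1` (`B_1 = B₀`, `finRung_of_quantitativeLineRate`) and `M → ∞` (`B_M → 0` by planar
sharpness, `periodicFin_of_lineRate`).  Numerically (`p_c² ≈ 0.0619`; planar Monte Carlo
`β(1..6) ≈ 0.262, 0.073, 0.021, 0.0063, 0.0019, 0.0006`): `B_1 ≈ 0.73, B_2 ≈ 0.16, B_3 ≈ 0.044, B_4 ≈ 0.013`,
so period `M` is certified as soon as `T₀ < 22, 101, 370, 1270, …` respectively — against a measured
`T₀ ≈ 1.24`.  Any explicit bound on the critical half-space line sum, however weak, certifies some period.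
-/

noncomputable section

namespace Summit.CriticalPhenomena.PercolationContinuityZ3.Theorems

open MeasureTheory Filter Topology Literature.Probability.Percolation Literature.Probability.LatticeModels
open scoped ENNReal

/-- `B_M = Σ_{j ≠ 0} β(M j)`: the fin-side line sum over the period-`M` feet. -/
def BM (M : ℕ) : ℝ≥0∞ := ∑' j : ℤ, Set.indicator {j : ℤ | j ≠ 0} (fun j => betaF ((M : ℤ) * j)) j

/-- `B_1 = B₀`. -/
theorem BM_one : BM 1 = B0 := by
  unfold BM B0
  refine tsum_congr fun j => ?_
  by_cases hj : j = 0
  · simp [hj]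
  · rw [Set.indicator_of_mem (by simpa using hj), Set.indicator_of_mem (by simpa using hj)]
    simp

/-- `T₀ ≤ Σ_w τ_ℍ(w)`. -/
theorem T0_le_tsum_tauH : T0 ≤ ∑' w, tauH w :=
  ENNReal.tsum_le_tsum fun w => Set.indicator_le_self _ _ w

/-- `LineRate` makes `T₀` finite. -/
theorem T0_ne_top_of_lineRate (hL : SoloBlindOpenRungs.LineRate) : T0 ≠ ⊤ :=
  ne_top_of_le_ne_top (tsum_tauH_ne_top hL) T0_le_tsum_tauH

/-- Fin kernel with the admissibility indicator kept: `κ_F(z,z') ≤ 1[adm] β(z'-z) · p_c`. -/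
theorem kerZ_false_le_admInd (Z : Set ℤ) (z z' : ℤ) :
    kerZ Z false z z' ≤ admInd Z z z' * (betaF (z' - z) * pcE) := by
  by_cases h : z ∈ Z ∧ z' ∈ Z ∧ z' ≠ z
  · obtain ⟨hz, hz', hne⟩ := h
    rw [admInd_of_mem hz hz' hne, one_mul]
    refine (kerZ_false_le_pc Z z z').trans_eq ?_
    rw [Set.indicator_of_mem (show z' - z ∈ {w : ℤ | w ≠ 0} from sub_ne_zero.2 hne)]
  · rw [kerZ, admInd_eq_zero h, zero_mul, zero_mul]

/-- `κ̄_F(Z_M) ≤ B_M · p_c` for `M ≥ 1`. -/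
theorem kerTot_false_ZM_le_pc (M : ℕ) (hM : 1 ≤ M) : kerTot (kerZ (ZM M)) false ≤ BM M * pcE := by
  have hMne : M ≠ 0 := by omega
  refine iSup_le fun z => ?_
  by_cases hz : z ∈ ZM M
  swap
  · have : ∀ z', kerZ (ZM M) false z z' = 0 := fun z' => by
      rw [kerZ, admInd_eq_zero (fun h => hz h.1), zero_mul]
    simp [tsum_congr this]
  obtain ⟨a, rfl⟩ := hz
  let g : ℤ → ℤ := fun j => (M : ℤ) * a + (M : ℤ) * j
  have hg : Function.Injective g := fun j j' h => by
    simpa [g, hMne] using h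
  let F : ℤ → ℝ≥0∞ := fun z' => admInd (ZM M) ((M : ℤ) * a) z' * (betaF (z' - (M : ℤ) * a) * pcE)
  have hsupp : Function.support F ⊆ Set.range g := by
    intro z' hz'
    by_contra hno
    apply hz'
    have : ¬((M : ℤ) * a ∈ ZM M ∧ z' ∈ ZM M ∧ z' ≠ (M : ℤ) * a) := by
      rintro ⟨-, ⟨b, rfl⟩, -⟩
      exact hno ⟨b - a, by simp [g]; ring⟩
    simp [F, admInd_eq_zero this]
  calc ∑' z', kerZ (ZM M) false ((M : ℤ) * a) z' ≤ ∑' z', F z' :=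
        ENNReal.tsum_le_tsum fun z' => kerZ_false_le_admInd (ZM M) _ z'
    _ = ∑' j, F (g j) := (hg.tsum_eq hsupp).symm
    _ ≤ ∑' j : ℤ, Set.indicator {j : ℤ | j ≠ 0} (fun j => betaF ((M : ℤ) * j)) j * pcE := by
        refine ENNReal.tsum_le_tsum fun j => ?_
        by_cases hj : j = 0
        · subst hj
          have : ¬((M : ℤ) * a ∈ ZM M ∧ g 0 ∈ ZM M ∧ g 0 ≠ (M : ℤ) * a) := fun h => h.2.2 (by simp [g])
          simp [F, admInd_eq_zero this]
        · rw [Set.indicator_of_mem (by exact hj)]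
          calc F (g j) ≤ 1 * (betaF (g j - (M : ℤ) * a) * pcE) := mul_le_mul' (admInd_le_one _ _) le_rfl
            _ = betaF ((M : ℤ) * j) * pcE := by
                rw [one_mul]
                simp only [g, add_sub_cancel_left]
    _ = BM M * pcE := ENNReal.tsum_mul_right

/-- **Every period under a quantitative line rate.** For `M ≥ 1`: if `T₀ < ∞` and
`p_c(ℤ³)² · T₀ · B_M < 1` then `M ∈ finPeriods` (`θ_{ℤ³[S_M]}(p_c) = 0`, at every root by
`theta_eq_zero_of_mem_finPeriods`). -/
theorem mem_finPeriods_of_quantitative {M : ℕ} (hM : 1 ≤ M) (hT : T0 ≠ ⊤)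
    (h : pcE ^ 2 * (T0 * BM M) < 1) : M ∈ finPeriods := by
  intro h0
  have hΓ : ∑' z, startZ (ZM M) (0 : Site 3) true z ≠ ⊤ :=
    ne_top_of_le_ne_top (by simpa using hT) ((tsum_startZ_le (ZM M)).trans tsum_tauH_le)
  have hρ : kerTot (kerZ (ZM M)) true * kerTot (kerZ (ZM M)) false < 1 := by
    calc kerTot (kerZ (ZM M)) true * kerTot (kerZ (ZM M)) false
        ≤ T0 * pcE * (BM M * pcE) := mul_le_mul' (kerTot_true_le_pc _) (kerTot_false_ZM_le_pc M hM)
      _ = pcE ^ 2 * (T0 * BM M) := by ring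
      _ < 1 := h
  have hzero := measure_percolatesVia_eq_zero (Z := ZM M) (0 : Site 3) true zero_mem_hsp hΓ hρ
  rw [theta_induce_eq_real_percolatesVia, measureReal_def]
  change (Pc (percolatesVia (KS (ZM M)) 0)).toReal = 0
  rw [hzero, ENNReal.toReal_zero]

/-- The same under `LineRate` (which supplies `T₀ < ∞` but no value for it). -/
theorem mem_finPeriods_of_lineRate_quantitative (hL : SoloBlindOpenRungs.LineRate) {M : ℕ} (hM : 1 ≤ M)
    (h : pcE ^ 2 * (T0 * BM M) < 1) : M ∈ finPeriods :=
  mem_finPeriods_of_quantitative hM (T0_ne_top_of_lineRate hL) h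

/-- Consistency with the `M = 1` file: the criterion with `B_1 = B₀` gives the fin rung. -/
theorem finRung_of_quantitative_one (h : pcE ^ 2 * (T0 * BM 1) < 1) : SoloBlindOpenRungs.FinRung := by
  rw [BM_one] at h
  exact finRung_of_quantitativeLineRate h

end Summit.CriticalPhenomena.PercolationContinuityZ3.Theorems

end
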